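import Summits.QuantumFields.YangMills.Theorems.BalabanUVNodesK0AxJoinResidualBoxScheme

/-!
# NODE O ∕ K0ᴬ cover — BOX ROAD: THE SCHEME RECEIPT (R-Sch) READS `ε₂₉` NOWHERE —
# P3 g92 №21 — (R-Sch) ⟺ ITS θ-FREE «NATURAL» EDITION (R-Sch♮) (no `thetaFill`, no `letI` preamble, no `∀ ε₂₉ > 0`), BY ONE-SIDED TRANSPORT THROUGH THE
# `rfl` FACES OF THE RECORD's FILL; THE K0ᴬ DOOR AND THE JUNCTION DOOR OF ✓`…K0AxJoinResidualBoxScheme` RE-CUT ON (R-Sch♮) — LENS P3 «weaken the target»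

LANDING NOTE (porter ▶ PTC-1 g4, 2026-08-31; AUTHORSHIP = ★ P3 g92 «weaken the target», HOME sketch `nodeO-cover/P3-BoxRoadSchemeNatural-v1.lean` sha16 93ddbc69ca235aab · 253 l. · 7 thm, no def, 0
sorry (№21: the fill-ERASED edition (R-Sch♮) of the scheme-of-record package — the `∀ ε₂₉ > 0` and the `thetaFill` preamble of (R-Sch) are VACUOUS letters because every Stage-8 face the package
reads is ε₂₉-free by one-sided `rfl` (`thetaFill_εbg`, `thetaFill_ρ8`, `recordW_eq`, `unitField_thetaFill` = print's `W_B = exp(iB·σ)`); `residualScheme_iff_residualSchemeNatural` + the doors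
re-keyed on (R-Sch♮))): landed VERBATIM except ONE DELETION — the face `thetaFill_εbg` (HOME :77, `rfl`, unused below) is DROPPED because the gate's dry-run named it a `dedup.landed` twin of the
tree's ✓`BalabanUVNodesPortS1.thetaFill_εbg_eq` (`…PortS1Sect5F1NumericsWitness` :28; cite that one) — and this paragraph added; 6 thm remain, under P3's basename
(`…Theorems/BalabanUVNodesK0AxJoinResidualBoxSchemeNatural.lean`, ns `…Theorems.K0AxJoinResidualBoxSchemeNatural`) as INTENT-79; one import ✓p825748 `…K0AxJoinResidualBoxScheme`; `--supports
stmt-QuantumFields-27238 --as helper` (NO `--workitem`; kind proof); ◆ CRIT-1 g38's cut: «(b) CUT — №21 → GO VERBATIM; axioms standard on 7 guarded names; J4 by NAME 7 × 0; J5′: no `def : Prop`,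
doors = ✓p825748 ∘ (:98).2, pure composition; J1′ on (R-Sch♮) read to the binder — same prefix, scheme PINNED, ten tokens with the fill's faces substituted, no letter weakened; SAME-WALL: LENS-P3
letters-only re-cut, (R-Sch♮) ⟺ (R-Sch) PROVED» (nodeO STATUS 2026-08-31T14:49:29Z) — the gate's STATEMENT-level `dedup.landed` on the one `rfl` face is the only deviation from «verbatim» (◆'s
name-level J4 could not see it).  HONEST (porter): `rfl` faces + a logical equivalence + re-keyed CONDITIONAL doors (credit nothing); (R-Sch♮)∕(R-Uk)∕(R-Old)∕(R-Win₁) and ⁸'s box texts OPEN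
Bałaban-strength content inhabited NOWHERE; nothing of Bałaban asserted, ported, discharged or refuted; K0ᴬ stmt-QuantumFields-27238 ∕ K1ᴬ 27239 OPEN — NOTHING of them proved; NODE O 0∕1; COUNT
8∕28 · K 1∕4 UNMOVED; finite 𝕋⁴ at fixed ε — NOT continuum ∕ OS ∕ Clay; the Yang–Mills mass gap is NOT proved by any of this.

Cell `ym-nodeO-ideate`, AUTHOR seat P3 g92 («weaken the target»); offered for ◆ CRIT-1's cut and ▶ PTC-1's filing
(`--supports stmt-QuantumFields-27238 --as helper`, kind proof; count-neutral).  [I] = [Balaban1987RG1], [15] = [Balaban1985Variational],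
[B9] = [Balaban1985BackgroundPropagators], [B12] = [Balaban1989LargeFieldII].

WHY (◆ CRIT-1 g38, STATUS l.5643, WATCH-POINT on ✓p825748's (R-Sch): «⁸ outputs `ε₂₉` with only `0 < ε₂₉`, so (R-Sch) is demanded at EVERY `ε₂₉ > 0` …
cheapest falsifier `ε₂₉ := 2`»).  ANSWER, at the kernel: the body of (R-Sch) reads the record's fill `θ := thetaFill F a₀ ε₂₉` ONLY through the Stage-8
faces `θ.εbg`, `θ.Vβ`, `θ.ιβ`, `θ.ρ8` (the last inside ✓`unitField`) and their carried instances, and EVERY ONE OF THEM IS `ε₂₉`-FREE BY ONE-SIDED `rfl`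
against a closed literal: `θ.Vβ = (Fin (suChartDim 2) → ℝ)` ∕ `θ.ιβ = Fin (suChartDim 2)` are ALREADY ✓`K0RecordFormatNames.thetaFill_Vβ ∕ thetaFill_ιβ`
(`…K0RecordFormatNamesLemmas13.lean` §4, DEF-1 g36 — CITED); §1 here adds the two the scheme body also reads, `θ.εbg = a₀` ([I] (0.21): the background radius IS
the letter `a₀`; cf. ✓`theta13OfThm1CCMWZB_εbg`) and `θ.ρ8 = suChartMap 2` (the CHART OF RECORD of 𝔰𝔲(2), ✓`Node00.stage8OfNumericsD`), and the two closed forms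
they yield: `recordW F a₀ ε₂₉ k K = (Fin d → Site → Fin (suChartDim 2) → ℝ)` and `unitField F θ k K B = readField F 2 (suOfMat 2) (μ x ↦ exp (suChartMap 2 (B μ x)))`
— print's `W_B = exp(iB·σ)` ([I] p. 264).  The letter `ε₂₉` fills ONLY the (2.9) slot `θ.ε₂₉` (✓`theta13OfNumericsZ := { stage12OfNumericsDZ … with ε₂₉ := ε₂₉ }`;
✓`Stage13Params.liveRepin₁₃_toStage8Params`), which no scheme token reads.  CONSEQUENCES TYPED HERE:
* §2 ★ `residualScheme_iff_residualSchemeNatural` — (R-Sch)_F ⟺ (R-Sch♮)_F, where (R-Sch♮) is (R-Sch) with the fill ERASED: the same ten scheme-of-record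
  tokens ([15] Props. 3, 4, 6, Thm 1 (8)–(9); [B9] (3.134)) stated over the closed chart `suChartMap 2` on `ℝ^{d(2)}`, radius `a₀` in `bgReg F 2 K (k+1) a₀ =
  {U | PlaqSmall (a₀·η_{k+1}²) U}` (✓`Node00.mem_bgReg_iff`, [I] (1.2) p. 260 — the `a₀η²`-REGULAR class, `a₀ ≤ aS`: [15] Thm 1's printed scope, NOT all
  `U` with `C_{k+1}(U) = V`), and NO `∀ ε₂₉ > 0` (the quantifier was a vacuous letter: ◆'s `ε₂₉ := 2` instance IS the small-`ε₂₉` clause).  Proof = quantifier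
  threading; each body-to-body step is a ONE-SIDED definitional unfolding through these faces (the natural side is θ-free).  This is the transport the
  cross-`ε₂₉` `rfl` CANNOT give — Lemmas13 (◆ CRIT-1 g35, l.4746): «a cross-ε rfl probe is too deep for the kernel»; re-measured here: `(thetaFill F a₀ ε).Vβ =
  (thetaFill F a₀ ε').Vβ := rfl` ↦ «(kernel) excessive memory consumption» (P3 scratch `eps_probe.lean`, 50 s; the comparison descends into `liveRepin₁₃`'s
  θ-dependent selector field before it meets the `ε₂₉` slot) — so the transport between two fills goes through the θ-free middle (R-Sch♮), one-sided each way.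
* §3 ★★ `record13SepCoPHInhabitedAx_of_sig8LR4Box_uk_old_schemeNatural` — THE K0ᴬ DOOR ON THE BOX ROAD displaying {⁸ `Sig8LR4Box`, (R-Uk), (R-Old), (R-Sch♮)}:
  ✓p825748's door with its fourth hypothesis read through §2 — one `∀`, one `letI`-preamble and every occurrence of `thetaFill` FEWER on the display; the
  three other receipts verbatim.
* §4 ★ `cofinalBetaSocketAxBody_allRadii_of_sig8LR4BoxCofinal_uk_old_schemeNatural_winC` — the junction door likewise ({cofinal ⁸, (R-Uk), (R-Old), (R-Sch♮), (R-Win₁)}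
  ⟹ `∀ F a > 0, CofinalBetaSocketAxBody F a`).

HONEST LABELS.  COUNT-NEUTRAL: `--as helper`, credits nothing; K0ᴬ `stmt-QuantumFields-27238` stays OPEN.  (R-Sch♮) is EQUIVALENT to (R-Sch) (§2) — weaker in
LETTERS (the display a supplier on the def-Y ∕ N07 lane proves directly: no fill, no `ε₂₉`), NOT in content: the ten tokens are Bałaban's [15] Prop. 6 regime,
the Sect. C analyticity token, Thm 1's minimiser chart with its range ∕ covering ∕ minimality rows and the Lie token, INHABITED NOWHERE as a package; ⁸'s box
texts are signed nowhere (⟨27930⟩ 1∕3 by registry); (R-Uk) ([15] Thm 1), (R-Old) ((1.22) token), (R-Win₁) OPEN.  No estimate of Bałaban is proved, moved or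
weakened here; §1 is `rfl` bookkeeping of the record's parameter dictionary.  A FINITE-𝕋⁴, fixed-`ε` door: nothing continuum ∕ OS ∕ Clay; the Yang–Mills
mass gap (`Summit.QuantumFields`) is NOT proved.  0 `def` · 0 `instance` · 0 `notation` · 0 `sorry`.
-/

set_option autoImplicit false

noncomputable section

open Filter Topology
open scoped BigOperators Matrix.Norms.L2Operator
open scoped InnerProductSpace

namespace Summit.QuantumFields.YangMills.Theorems.K0AxJoinResidualBoxSchemeNatural

open Literature.MathematicalPhysics.QuantumFieldTheory.Balaban1983to89
open Literature.MathematicalPhysics.QuantumFieldTheory.Balaban1983to89.Node00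
open Literature.MathematicalPhysics.QuantumFieldTheory.Balaban1983to89.T4Continuum (T4Family)
open Literature.MathematicalPhysics.QuantumFieldTheory.Balaban1983to89.FlowStep
open Literature.MathematicalPhysics.QuantumFieldTheory.Balaban1983to89.FlowStepRuns
open B12GaugeOrbits021 (OrbitRel)
open B11Prop6Scheme (mapT)
open B11Eq103H1Complex (BondL2K SiteL2K)
open NormedSpace (exp)
open Summit.QuantumFields.YangMills.Theorems
open Summit.QuantumFields.YangMills.Theorems.K0RecordFormatNames
open Summit.QuantumFields.YangMills.Theorems.K0AxMomentRoad
open Summit.QuantumFields.YangMills.Theorems.PortHRecordJoin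
open Summit.QuantumFields.YangMills.Theorems.BalabanUVNodesPortS1 (Sig8LR4Box)
open Summit.QuantumFields.YangMills.Theorems.K0AxJunctionWindow (Sig8LR4BoxBelow)
open Summit.QuantumFields.YangMills.Theorems.K0AxJoinResidualBoxScheme (record13SepCoPHInhabitedAx_of_sig8LR4Box_uk_old_scheme
  cofinalBetaSocketAxBody_allRadii_of_sig8LR4BoxCofinal_uk_old_scheme_winC)

/-! ## §1  The `rfl` faces of the record's fill `thetaFill F a₀ ε₂₉` read by the scheme tokens — every one `ε₂₉`-free

The type-level faces `θ.Vβ = (Fin (suChartDim 2) → ℝ)` ∕ `θ.ιβ = Fin (suChartDim 2)` are ✓`K0RecordFormatNames.thetaFill_Vβ ∕ thetaFill_ιβ`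
(`…K0RecordFormatNamesLemmas13.lean` :116 ∕ :119, DEF-1 g36) and are CITED, not restated; the four below are the remaining faces the scheme body reads. -/

/-- FACE (`rfl`): its chart is THE CHART OF RECORD `suChartMap 2 : ℝ^{d(2)} →L[ℝ] M₂(ℂ)` (onto 𝔰𝔲(2)). [cite: Balaban1987RG1, (1.20)–(1.21) p.264 (bookkeeping)] -/
theorem thetaFill_ρ8 (F : T4Family) (a₀ ε₂₉ : ℝ) : (thetaFill F a₀ ε₂₉).ρ8 = suChartMap 2 := rfl

/-- FACE (`rfl`): the record's field space `W K` is the closed Pi type `Fin d → Site_{k+1} → ℝ^{d(2)}` — `ε₂₉`-free AND `a₀`-free. [cite: Balaban1987RG1, (1.20) p.264 (bookkeeping)] -/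
theorem recordW_eq (F : T4Family) (a₀ ε₂₉ : ℝ) (k K : ℕ) :
    recordW F a₀ ε₂₉ k K = (Fin (F.P K).d → Site (F.P K) (k + 1) → Fin (suChartDim 2) → ℝ) := rfl

/-- FACE (`rfl`): the charted unit-lattice configuration at the record's fill is print's `W_B = exp(iB·σ)` read through the chart of record — `ε₂₉`-free AND
`a₀`-free. [cite: Balaban1987RG1, p.264 (before (1.20)) (bookkeeping)] -/
theorem unitField_thetaFill (F : T4Family) (a₀ ε₂₉ : ℝ) (k K : ℕ) (B : Fin (F.P K).d → Site (F.P K) (k + 1) → Fin (suChartDim 2) → ℝ) :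
    unitField F (thetaFill F a₀ ε₂₉) k K B = readField F 2 (suOfMat 2) fun μ x => exp (suChartMap 2 (B μ x)) := rfl

/-! ## §2  (R-Sch) ⟺ (R-Sch♮): the scheme receipt with the fill erased -/

/-- ★ **(R-Sch)_F ⟺ (R-Sch♮)_F — THE SCHEME-OF-RECORD RECEIPT READS `ε₂₉` NOWHERE.**  Left: ✓p825748's displayed receipt (R-Sch) (the record's fill
`θ := thetaFill F a₀ ε₂₉` instantiated, `∀ ε₂₉ > 0`).  Right: the same ten tokens with the fill ERASED through the §1 faces — radius `a₀`, fields
`B : Fin d → Site_{k+1} → ℝ^{d(2)}` near `0`, the Lie token at `readField F 2 (suOfMat 2) (μ x ↦ exp (suChartMap 2 (B μ x)))` — and NO `ε₂₉`.  Proof: quantifier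
threading (`ε₂₉ := 1` left-to-right; the bound `ε₂₉` ignored right-to-left); each body-to-body step is a one-sided definitional unfolding.  Bookkeeping; no token
is proved. [cite: Balaban1985Variational, Prop. 6 p.295, Thm 1 p.279 and (8)–(9); Balaban1985BackgroundPropagators, (3.134) p.69; Balaban1987RG1, (0.21) p.256, (1.2) p.260, (1.20) p.264] -/
theorem residualScheme_iff_residualSchemeNatural (F : T4Family) :
    (      ∃ aS : ℝ, 0 < aS ∧ ∀ a₀ : ℝ, 0 < a₀ → a₀ ≤ aS → ∃ M₀ : ℕ, ∀ Mc : ℕ, McGuard F Mc → M₀ ≤ Mc → ∀ ε₂₉ : ℝ, 0 < ε₂₉ → ∀ k n : ℕ,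
        letI θ := thetaFill F a₀ ε₂₉; letI := θ.instVβ₁; letI := θ.instVβ₂; letI := θ.instιβ;
        haveI := factL F; haveI := factEta F (recordK₀ F Mc k + n) (k + 1); haveI := factC0 F (recordK₀ F Mc k + n) (k + 1); haveI := wBRec_fact F (recordK₀ F Mc k + n) (k + 1);
        ∃ (Ω : ℕ → Set (Site (F.P (recordK₀ F Mc k + n)) 0)) (dom : Set (GaugeField (F.P (recordK₀ F Mc k + n)) (k + 1) (SU 2))) (levB : PBond (F.P (recordK₀ F Mc k + n)) (k + 1) → ℕ)
          (Gp : SiteL2K ℂ (F.P (recordK₀ F Mc k + n)).d (fun _ => (F.P (recordK₀ F Mc k + n)).sitesPerDir 0) (c0Rec F (recordK₀ F Mc k + n) (k + 1)) (WRec 2) →ₗ[ℂ]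
            SiteL2K ℂ (F.P (recordK₀ F Mc k + n)).d (fun _ => (F.P (recordK₀ F Mc k + n)).sitesPerDir 0) (c0Rec F (recordK₀ F Mc k + n) (k + 1)) (WRec 2))
          (Δ2 : BondL2K ℂ (F.P (recordK₀ F Mc k + n)).d (fun _ => (F.P (recordK₀ F Mc k + n)).sitesPerDir 0) (c0Rec F (recordK₀ F Mc k + n) (k + 1)) (WRec 2) →ₗ[ℂ]
            BondL2K ℂ (F.P (recordK₀ F Mc k + n)).d (fun _ => (F.P (recordK₀ F Mc k + n)).sitesPerDir 0) (c0Rec F (recordK₀ F Mc k + n) (k + 1)) (WRec 2)) (a : ℝ)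
          (hposπ : ∀ x, x ≠ 0 → 0 < RCLike.re ⟪x, laplaceAOfRecordAt F 2 (k + 1) (1 : GaugeField (F.P (recordK₀ F Mc k + n)) 0 (SU 2))
            (hessOpOfRecord128 F 2 (k + 1) (1 : GaugeField (F.P (recordK₀ F Mc k + n)) 0 (SU 2)) Gp (QflatOfRecord F 2 (k + 1)) Δ2)
            (QOfRecord F 2 (k + 1) (1 : GaugeField (F.P (recordK₀ F Mc k + n)) 0 (SU 2))) (QflatOfRecord F 2 (k + 1)) a x⟫_ℂ)
          (hposb : ∀ x, x ≠ 0 → 0 < RCLike.re ⟪x, laplaceAOfRecord F 2 (k + 1) (1 : GaugeField (F.P (recordK₀ F Mc k + n)) 0 (SU 2))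
            (QOfRecord F 2 (k + 1) (1 : GaugeField (F.P (recordK₀ F Mc k + n)) 0 (SU 2))) (QflatOfRecord F 2 (k + 1)) a x⟫_ℂ)
          (hQ : Function.Surjective (QOfRecord F 2 (k + 1) (1 : GaugeField (F.P (recordK₀ F Mc k + n)) 0 (SU 2)))) (εC B₀ C₄ a₃ j a𝔄 ε₄ : ℝ)
          (S : BgSchemeOnLit F 2 (recordK₀ F Mc k + n) (k + 1) Ω 1)
          (_ : S = bgSchemeOfRecord F 2 (recordK₀ F Mc k + n) (k + 1) Ω 1 dom levB Gp Δ2 a hposπ hposb hQ εC B₀ C₄ a₃ j a𝔄 ε₄)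
          (Kc : GaugeField (F.P (recordK₀ F Mc k + n)) (k + 1) (SU 2) → Set (Space115Lit F 2 (recordK₀ F Mc k + n) (k + 1) Ω 1)),
          S.RegimeTok ∧ WAnalyticTok F 2 (recordK₀ F Mc k + n) (k + 1) Ω 1 levB Gp a hposb hQ εC a₃ ∧ 0 < a𝔄 ∧
          dom ∈ 𝓝 (1 : GaugeField (F.P (recordK₀ F Mc k + n)) (k + 1) (SU 2)) ∧
          (∀ V ∈ S.dom, ∀ A ∈ Kc V, S.chart V A ∈ bgReg F 2 (recordK₀ F Mc k + n) (k + 1) θ.εbg ∧ Averaging.iter (avOfRecord F 2 (recordK₀ F Mc k + n)) (k + 1) (S.chart V A) = V) ∧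
          (∀ V ∈ S.dom, ∀ U : GaugeField (F.P (recordK₀ F Mc k + n)) 0 (SU 2), U ∈ bgReg F 2 (recordK₀ F Mc k + n) (k + 1) θ.εbg →
            Averaging.iter (avOfRecord F 2 (recordK₀ F Mc k + n)) (k + 1) U = V → ∃ A ∈ Kc V, OrbitRel (k + 1) (S.chart V A) U) ∧
          (∀ V ∈ S.dom, ∀ A ∈ Kc V, IsMinOn (wilsonAction4 ∘ S.chart V) (Kc V) A →
            ‖A‖ ≤ S.ε₄ ∧ mapT (S.𝒢 V) 0 (S.W V) (S.J V) (S.𝔄 V) A = A) ∧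
          (∀ V ∈ S.dom, S.sol V ∈ Kc V) ∧ (∀ V ∈ S.dom, IsMinOn (wilsonAction4 ∘ S.chart V) (Kc V) (S.sol V)) ∧
          (∀ᶠ B in 𝓝 (0 : recordW F a₀ ε₂₉ k (recordK₀ F Mc k + n)), S.LieTokAt (unitField F θ k (recordK₀ F Mc k + n) B))) ↔
    (      ∃ aS : ℝ, 0 < aS ∧ ∀ a₀ : ℝ, 0 < a₀ → a₀ ≤ aS → ∃ M₀ : ℕ, ∀ Mc : ℕ, McGuard F Mc → M₀ ≤ Mc → ∀ k n : ℕ,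
        haveI := factL F; haveI := factEta F (recordK₀ F Mc k + n) (k + 1); haveI := factC0 F (recordK₀ F Mc k + n) (k + 1); haveI := wBRec_fact F (recordK₀ F Mc k + n) (k + 1);
        ∃ (Ω : ℕ → Set (Site (F.P (recordK₀ F Mc k + n)) 0)) (dom : Set (GaugeField (F.P (recordK₀ F Mc k + n)) (k + 1) (SU 2))) (levB : PBond (F.P (recordK₀ F Mc k + n)) (k + 1) → ℕ)
          (Gp : SiteL2K ℂ (F.P (recordK₀ F Mc k + n)).d (fun _ => (F.P (recordK₀ F Mc k + n)).sitesPerDir 0) (c0Rec F (recordK₀ F Mc k + n) (k + 1)) (WRec 2) →ₗ[ℂ]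
            SiteL2K ℂ (F.P (recordK₀ F Mc k + n)).d (fun _ => (F.P (recordK₀ F Mc k + n)).sitesPerDir 0) (c0Rec F (recordK₀ F Mc k + n) (k + 1)) (WRec 2))
          (Δ2 : BondL2K ℂ (F.P (recordK₀ F Mc k + n)).d (fun _ => (F.P (recordK₀ F Mc k + n)).sitesPerDir 0) (c0Rec F (recordK₀ F Mc k + n) (k + 1)) (WRec 2) →ₗ[ℂ]
            BondL2K ℂ (F.P (recordK₀ F Mc k + n)).d (fun _ => (F.P (recordK₀ F Mc k + n)).sitesPerDir 0) (c0Rec F (recordK₀ F Mc k + n) (k + 1)) (WRec 2)) (a : ℝ)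
          (hposπ : ∀ x, x ≠ 0 → 0 < RCLike.re ⟪x, laplaceAOfRecordAt F 2 (k + 1) (1 : GaugeField (F.P (recordK₀ F Mc k + n)) 0 (SU 2))
            (hessOpOfRecord128 F 2 (k + 1) (1 : GaugeField (F.P (recordK₀ F Mc k + n)) 0 (SU 2)) Gp (QflatOfRecord F 2 (k + 1)) Δ2)
            (QOfRecord F 2 (k + 1) (1 : GaugeField (F.P (recordK₀ F Mc k + n)) 0 (SU 2))) (QflatOfRecord F 2 (k + 1)) a x⟫_ℂ)
          (hposb : ∀ x, x ≠ 0 → 0 < RCLike.re ⟪x, laplaceAOfRecord F 2 (k + 1) (1 : GaugeField (F.P (recordK₀ F Mc k + n)) 0 (SU 2))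
            (QOfRecord F 2 (k + 1) (1 : GaugeField (F.P (recordK₀ F Mc k + n)) 0 (SU 2))) (QflatOfRecord F 2 (k + 1)) a x⟫_ℂ)
          (hQ : Function.Surjective (QOfRecord F 2 (k + 1) (1 : GaugeField (F.P (recordK₀ F Mc k + n)) 0 (SU 2)))) (εC B₀ C₄ a₃ j a𝔄 ε₄ : ℝ)
          (S : BgSchemeOnLit F 2 (recordK₀ F Mc k + n) (k + 1) Ω 1)
          (_ : S = bgSchemeOfRecord F 2 (recordK₀ F Mc k + n) (k + 1) Ω 1 dom levB Gp Δ2 a hposπ hposb hQ εC B₀ C₄ a₃ j a𝔄 ε₄)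
          (Kc : GaugeField (F.P (recordK₀ F Mc k + n)) (k + 1) (SU 2) → Set (Space115Lit F 2 (recordK₀ F Mc k + n) (k + 1) Ω 1)),
          S.RegimeTok ∧ WAnalyticTok F 2 (recordK₀ F Mc k + n) (k + 1) Ω 1 levB Gp a hposb hQ εC a₃ ∧ 0 < a𝔄 ∧
          dom ∈ 𝓝 (1 : GaugeField (F.P (recordK₀ F Mc k + n)) (k + 1) (SU 2)) ∧
          (∀ V ∈ S.dom, ∀ A ∈ Kc V, S.chart V A ∈ bgReg F 2 (recordK₀ F Mc k + n) (k + 1) a₀ ∧ Averaging.iter (avOfRecord F 2 (recordK₀ F Mc k + n)) (k + 1) (S.chart V A) = V) ∧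
          (∀ V ∈ S.dom, ∀ U : GaugeField (F.P (recordK₀ F Mc k + n)) 0 (SU 2), U ∈ bgReg F 2 (recordK₀ F Mc k + n) (k + 1) a₀ →
            Averaging.iter (avOfRecord F 2 (recordK₀ F Mc k + n)) (k + 1) U = V → ∃ A ∈ Kc V, OrbitRel (k + 1) (S.chart V A) U) ∧
          (∀ V ∈ S.dom, ∀ A ∈ Kc V, IsMinOn (wilsonAction4 ∘ S.chart V) (Kc V) A →
            ‖A‖ ≤ S.ε₄ ∧ mapT (S.𝒢 V) 0 (S.W V) (S.J V) (S.𝔄 V) A = A) ∧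
          (∀ V ∈ S.dom, S.sol V ∈ Kc V) ∧ (∀ V ∈ S.dom, IsMinOn (wilsonAction4 ∘ S.chart V) (Kc V) (S.sol V)) ∧
          (∀ᶠ B in 𝓝 (0 : Fin (F.P (recordK₀ F Mc k + n)).d → Site (F.P (recordK₀ F Mc k + n)) (k + 1) → Fin (suChartDim 2) → ℝ),
            S.LieTokAt (readField F 2 (suOfMat 2) fun μ x => exp (suChartMap 2 (B μ x))))) := by
  constructor
  · rintro ⟨aS, haS, h⟩
    refine ⟨aS, haS, fun a₀ ha₀ hle => ?_⟩
    obtain ⟨M₀, hM⟩ := h a₀ ha₀ hle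
    exact ⟨M₀, fun Mc hG hMc k n => hM Mc hG hMc 1 one_pos k n⟩
  · rintro ⟨aS, haS, h⟩
    refine ⟨aS, haS, fun a₀ ha₀ hle => ?_⟩
    obtain ⟨M₀, hM⟩ := h a₀ ha₀ hle
    exact ⟨M₀, fun Mc hG hMc ε₂₉ _ k n => hM Mc hG hMc k n⟩

/-! ## §3  The K0ᴬ door on the box road, displaying {⁸, (R-Uk), (R-Old), (R-Sch♮)} -/

/-- ★★ **THE K0ᴬ DOOR ON THE BOX ROAD WITH THE NATURAL SCHEME RECEIPT.**  ✓p825748 `record13SepCoPHInhabitedAx_of_sig8LR4Box_uk_old_scheme` with its fourth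
hypothesis read through §2: displayed are ⁸ `Sig8LR4Box` (the port's signed text, OPEN), (R-Uk) ([15] Thm 1, OPEN), (R-Old) (the (1.22) token `TokP9L4Old`,
OPEN) and (R-Sch♮) — the scheme-of-record tokens at radius `a₀` over the chart of record, with NO fill and NO `ε₂₉` (OPEN; def-Y ∕ N07 lane).  COUNT-NEUTRAL
(`--as helper`): a door, not an inhabitant; K0ᴬ `stmt-QuantumFields-27238` stays OPEN. [cite: Balaban1989LargeFieldII, (1.54)–(1.56) p.19; Balaban1987RG1, Thm 1 p.259, (1.22) p.264; Balaban1985Variational, Thm 1 p.279, Prop. 6 p.295] -/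
theorem record13SepCoPHInhabitedAx_of_sig8LR4Box_uk_old_schemeNatural
    (h8 : ∀ F, Sig8LR4Box F)
    (hUk : ∀ F : T4Family,
      ∃ aU : ℝ, 0 < aU ∧ ∀ (B₃ a₀ a₁ : ℝ), 2 * (F.L : ℝ) ^ 2 ≤ B₃ → 0 < a₀ → a₀ ≤ aU → 0 < a₁ → ∃ M₀ : ℕ, ∀ Mc : ℕ, McGuard F Mc → M₀ ≤ Mc →
        (∀ ε₁ : ℝ, 0 < ε₁ → ε₁ ≤ a₁ → B₃ * ε₁ ≤ a₀ → ∀ (k n : ℕ) (V : GaugeField (F.P (recordK₀ F Mc k + n)) (k + 1) (SU 2)), PlaqSmall ε₁ V →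
          UkExists F 2 (recordK₀ F Mc k + n) (k + 1) a₀ V ∧ UniqueUkOrbit F 2 (recordK₀ F Mc k + n) (k + 1) a₀ V))
    (hOld : ∀ F : T4Family,
      ∃ aT : ℝ, 0 < aT ∧ ∀ a₀ : ℝ, 0 < a₀ → a₀ ≤ aT → ∃ M₀ : ℕ, ∀ Mc : ℕ, McGuard F Mc → M₀ ≤ Mc → TokP9L4Old F Mc a₀)
    (hSch : ∀ F : T4Family,
      ∃ aS : ℝ, 0 < aS ∧ ∀ a₀ : ℝ, 0 < a₀ → a₀ ≤ aS → ∃ M₀ : ℕ, ∀ Mc : ℕ, McGuard F Mc → M₀ ≤ Mc → ∀ k n : ℕ,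
        haveI := factL F; haveI := factEta F (recordK₀ F Mc k + n) (k + 1); haveI := factC0 F (recordK₀ F Mc k + n) (k + 1); haveI := wBRec_fact F (recordK₀ F Mc k + n) (k + 1);
        ∃ (Ω : ℕ → Set (Site (F.P (recordK₀ F Mc k + n)) 0)) (dom : Set (GaugeField (F.P (recordK₀ F Mc k + n)) (k + 1) (SU 2))) (levB : PBond (F.P (recordK₀ F Mc k + n)) (k + 1) → ℕ)
          (Gp : SiteL2K ℂ (F.P (recordK₀ F Mc k + n)).d (fun _ => (F.P (recordK₀ F Mc k + n)).sitesPerDir 0) (c0Rec F (recordK₀ F Mc k + n) (k + 1)) (WRec 2) →ₗ[ℂ]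
            SiteL2K ℂ (F.P (recordK₀ F Mc k + n)).d (fun _ => (F.P (recordK₀ F Mc k + n)).sitesPerDir 0) (c0Rec F (recordK₀ F Mc k + n) (k + 1)) (WRec 2))
          (Δ2 : BondL2K ℂ (F.P (recordK₀ F Mc k + n)).d (fun _ => (F.P (recordK₀ F Mc k + n)).sitesPerDir 0) (c0Rec F (recordK₀ F Mc k + n) (k + 1)) (WRec 2) →ₗ[ℂ]
            BondL2K ℂ (F.P (recordK₀ F Mc k + n)).d (fun _ => (F.P (recordK₀ F Mc k + n)).sitesPerDir 0) (c0Rec F (recordK₀ F Mc k + n) (k + 1)) (WRec 2)) (a : ℝ)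
          (hposπ : ∀ x, x ≠ 0 → 0 < RCLike.re ⟪x, laplaceAOfRecordAt F 2 (k + 1) (1 : GaugeField (F.P (recordK₀ F Mc k + n)) 0 (SU 2))
            (hessOpOfRecord128 F 2 (k + 1) (1 : GaugeField (F.P (recordK₀ F Mc k + n)) 0 (SU 2)) Gp (QflatOfRecord F 2 (k + 1)) Δ2)
            (QOfRecord F 2 (k + 1) (1 : GaugeField (F.P (recordK₀ F Mc k + n)) 0 (SU 2))) (QflatOfRecord F 2 (k + 1)) a x⟫_ℂ)
          (hposb : ∀ x, x ≠ 0 → 0 < RCLike.re ⟪x, laplaceAOfRecord F 2 (k + 1) (1 : GaugeField (F.P (recordK₀ F Mc k + n)) 0 (SU 2))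
            (QOfRecord F 2 (k + 1) (1 : GaugeField (F.P (recordK₀ F Mc k + n)) 0 (SU 2))) (QflatOfRecord F 2 (k + 1)) a x⟫_ℂ)
          (hQ : Function.Surjective (QOfRecord F 2 (k + 1) (1 : GaugeField (F.P (recordK₀ F Mc k + n)) 0 (SU 2)))) (εC B₀ C₄ a₃ j a𝔄 ε₄ : ℝ)
          (S : BgSchemeOnLit F 2 (recordK₀ F Mc k + n) (k + 1) Ω 1)
          (_ : S = bgSchemeOfRecord F 2 (recordK₀ F Mc k + n) (k + 1) Ω 1 dom levB Gp Δ2 a hposπ hposb hQ εC B₀ C₄ a₃ j a𝔄 ε₄)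
          (Kc : GaugeField (F.P (recordK₀ F Mc k + n)) (k + 1) (SU 2) → Set (Space115Lit F 2 (recordK₀ F Mc k + n) (k + 1) Ω 1)),
          S.RegimeTok ∧ WAnalyticTok F 2 (recordK₀ F Mc k + n) (k + 1) Ω 1 levB Gp a hposb hQ εC a₃ ∧ 0 < a𝔄 ∧
          dom ∈ 𝓝 (1 : GaugeField (F.P (recordK₀ F Mc k + n)) (k + 1) (SU 2)) ∧
          (∀ V ∈ S.dom, ∀ A ∈ Kc V, S.chart V A ∈ bgReg F 2 (recordK₀ F Mc k + n) (k + 1) a₀ ∧ Averaging.iter (avOfRecord F 2 (recordK₀ F Mc k + n)) (k + 1) (S.chart V A) = V) ∧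
          (∀ V ∈ S.dom, ∀ U : GaugeField (F.P (recordK₀ F Mc k + n)) 0 (SU 2), U ∈ bgReg F 2 (recordK₀ F Mc k + n) (k + 1) a₀ →
            Averaging.iter (avOfRecord F 2 (recordK₀ F Mc k + n)) (k + 1) U = V → ∃ A ∈ Kc V, OrbitRel (k + 1) (S.chart V A) U) ∧
          (∀ V ∈ S.dom, ∀ A ∈ Kc V, IsMinOn (wilsonAction4 ∘ S.chart V) (Kc V) A →
            ‖A‖ ≤ S.ε₄ ∧ mapT (S.𝒢 V) 0 (S.W V) (S.J V) (S.𝔄 V) A = A) ∧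
          (∀ V ∈ S.dom, S.sol V ∈ Kc V) ∧ (∀ V ∈ S.dom, IsMinOn (wilsonAction4 ∘ S.chart V) (Kc V) (S.sol V)) ∧
          (∀ᶠ B in 𝓝 (0 : Fin (F.P (recordK₀ F Mc k + n)).d → Site (F.P (recordK₀ F Mc k + n)) (k + 1) → Fin (suChartDim 2) → ℝ),
            S.LieTokAt (readField F 2 (suOfMat 2) fun μ x => exp (suChartMap 2 (B μ x))))) :
    Summit.QuantumFields.YangMills.Theses.BalabanUVNodes.Record13SepCoPHInhabitedAx :=
  record13SepCoPHInhabitedAx_of_sig8LR4Box_uk_old_scheme h8 hUk hOld fun F => (residualScheme_iff_residualSchemeNatural F).2 (hSch F)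

/-! ## §4  The junction door, displaying {cofinal ⁸, (R-Uk), (R-Old), (R-Sch♮), (R-Win₁)} -/

/-- ★ **THE JUNCTION DOOR WITH THE NATURAL SCHEME RECEIPT.**  ✓p825748 `cofinalBetaSocketAxBody_allRadii_of_sig8LR4BoxCofinal_uk_old_scheme_winC` with its
fourth hypothesis read through §2.  COUNT-NEUTRAL; `hβc` is one of the junction's antecedents, nothing of K1ᴬ is proved. [cite: Balaban1989LargeFieldII, (1.54)–(1.56) p.19; Balaban1987RG1, Thm 1 p.259, (1.20)–(1.22) p.264; Balaban1985Variational, Thm 1 p.279, Prop. 6 p.295] -/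
theorem cofinalBetaSocketAxBody_allRadii_of_sig8LR4BoxCofinal_uk_old_schemeNatural_winC
    (h8c : ∀ (F : T4Family) (εw : ℝ), 0 < εw → Sig8LR4BoxBelow F εw)
    (hUk : ∀ F : T4Family,
      ∃ aU : ℝ, 0 < aU ∧ ∀ (B₃ a₀ a₁ : ℝ), 2 * (F.L : ℝ) ^ 2 ≤ B₃ → 0 < a₀ → a₀ ≤ aU → 0 < a₁ → ∃ M₀ : ℕ, ∀ Mc : ℕ, McGuard F Mc → M₀ ≤ Mc →
        (∀ ε₁ : ℝ, 0 < ε₁ → ε₁ ≤ a₁ → B₃ * ε₁ ≤ a₀ → ∀ (k n : ℕ) (V : GaugeField (F.P (recordK₀ F Mc k + n)) (k + 1) (SU 2)), PlaqSmall ε₁ V →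
          UkExists F 2 (recordK₀ F Mc k + n) (k + 1) a₀ V ∧ UniqueUkOrbit F 2 (recordK₀ F Mc k + n) (k + 1) a₀ V))
    (hOld : ∀ F : T4Family,
      ∃ aT : ℝ, 0 < aT ∧ ∀ a₀ : ℝ, 0 < a₀ → a₀ ≤ aT → ∃ M₀ : ℕ, ∀ Mc : ℕ, McGuard F Mc → M₀ ≤ Mc → TokP9L4Old F Mc a₀)
    (hSch : ∀ F : T4Family,
      ∃ aS : ℝ, 0 < aS ∧ ∀ a₀ : ℝ, 0 < a₀ → a₀ ≤ aS → ∃ M₀ : ℕ, ∀ Mc : ℕ, McGuard F Mc → M₀ ≤ Mc → ∀ k n : ℕ,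
        haveI := factL F; haveI := factEta F (recordK₀ F Mc k + n) (k + 1); haveI := factC0 F (recordK₀ F Mc k + n) (k + 1); haveI := wBRec_fact F (recordK₀ F Mc k + n) (k + 1);
        ∃ (Ω : ℕ → Set (Site (F.P (recordK₀ F Mc k + n)) 0)) (dom : Set (GaugeField (F.P (recordK₀ F Mc k + n)) (k + 1) (SU 2))) (levB : PBond (F.P (recordK₀ F Mc k + n)) (k + 1) → ℕ)
          (Gp : SiteL2K ℂ (F.P (recordK₀ F Mc k + n)).d (fun _ => (F.P (recordK₀ F Mc k + n)).sitesPerDir 0) (c0Rec F (recordK₀ F Mc k + n) (k + 1)) (WRec 2) →ₗ[ℂ]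
            SiteL2K ℂ (F.P (recordK₀ F Mc k + n)).d (fun _ => (F.P (recordK₀ F Mc k + n)).sitesPerDir 0) (c0Rec F (recordK₀ F Mc k + n) (k + 1)) (WRec 2))
          (Δ2 : BondL2K ℂ (F.P (recordK₀ F Mc k + n)).d (fun _ => (F.P (recordK₀ F Mc k + n)).sitesPerDir 0) (c0Rec F (recordK₀ F Mc k + n) (k + 1)) (WRec 2) →ₗ[ℂ]
            BondL2K ℂ (F.P (recordK₀ F Mc k + n)).d (fun _ => (F.P (recordK₀ F Mc k + n)).sitesPerDir 0) (c0Rec F (recordK₀ F Mc k + n) (k + 1)) (WRec 2)) (a : ℝ)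
          (hposπ : ∀ x, x ≠ 0 → 0 < RCLike.re ⟪x, laplaceAOfRecordAt F 2 (k + 1) (1 : GaugeField (F.P (recordK₀ F Mc k + n)) 0 (SU 2))
            (hessOpOfRecord128 F 2 (k + 1) (1 : GaugeField (F.P (recordK₀ F Mc k + n)) 0 (SU 2)) Gp (QflatOfRecord F 2 (k + 1)) Δ2)
            (QOfRecord F 2 (k + 1) (1 : GaugeField (F.P (recordK₀ F Mc k + n)) 0 (SU 2))) (QflatOfRecord F 2 (k + 1)) a x⟫_ℂ)
          (hposb : ∀ x, x ≠ 0 → 0 < RCLike.re ⟪x, laplaceAOfRecord F 2 (k + 1) (1 : GaugeField (F.P (recordK₀ F Mc k + n)) 0 (SU 2))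
            (QOfRecord F 2 (k + 1) (1 : GaugeField (F.P (recordK₀ F Mc k + n)) 0 (SU 2))) (QflatOfRecord F 2 (k + 1)) a x⟫_ℂ)
          (hQ : Function.Surjective (QOfRecord F 2 (k + 1) (1 : GaugeField (F.P (recordK₀ F Mc k + n)) 0 (SU 2)))) (εC B₀ C₄ a₃ j a𝔄 ε₄ : ℝ)
          (S : BgSchemeOnLit F 2 (recordK₀ F Mc k + n) (k + 1) Ω 1)
          (_ : S = bgSchemeOfRecord F 2 (recordK₀ F Mc k + n) (k + 1) Ω 1 dom levB Gp Δ2 a hposπ hposb hQ εC B₀ C₄ a₃ j a𝔄 ε₄)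
          (Kc : GaugeField (F.P (recordK₀ F Mc k + n)) (k + 1) (SU 2) → Set (Space115Lit F 2 (recordK₀ F Mc k + n) (k + 1) Ω 1)),
          S.RegimeTok ∧ WAnalyticTok F 2 (recordK₀ F Mc k + n) (k + 1) Ω 1 levB Gp a hposb hQ εC a₃ ∧ 0 < a𝔄 ∧
          dom ∈ 𝓝 (1 : GaugeField (F.P (recordK₀ F Mc k + n)) (k + 1) (SU 2)) ∧
          (∀ V ∈ S.dom, ∀ A ∈ Kc V, S.chart V A ∈ bgReg F 2 (recordK₀ F Mc k + n) (k + 1) a₀ ∧ Averaging.iter (avOfRecord F 2 (recordK₀ F Mc k + n)) (k + 1) (S.chart V A) = V) ∧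
          (∀ V ∈ S.dom, ∀ U : GaugeField (F.P (recordK₀ F Mc k + n)) 0 (SU 2), U ∈ bgReg F 2 (recordK₀ F Mc k + n) (k + 1) a₀ →
            Averaging.iter (avOfRecord F 2 (recordK₀ F Mc k + n)) (k + 1) U = V → ∃ A ∈ Kc V, OrbitRel (k + 1) (S.chart V A) U) ∧
          (∀ V ∈ S.dom, ∀ A ∈ Kc V, IsMinOn (wilsonAction4 ∘ S.chart V) (Kc V) A →
            ‖A‖ ≤ S.ε₄ ∧ mapT (S.𝒢 V) 0 (S.W V) (S.J V) (S.𝔄 V) A = A) ∧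
          (∀ V ∈ S.dom, S.sol V ∈ Kc V) ∧ (∀ V ∈ S.dom, IsMinOn (wilsonAction4 ∘ S.chart V) (Kc V) (S.sol V)) ∧
          (∀ᶠ B in 𝓝 (0 : Fin (F.P (recordK₀ F Mc k + n)).d → Site (F.P (recordK₀ F Mc k + n)) (k + 1) → Fin (suChartDim 2) → ℝ),
            S.LieTokAt (readField F 2 (suOfMat 2) fun μ x => exp (suChartMap 2 (B μ x)))))
    (hWinC : ∀ F : T4Family,
      ∃ aW : ℝ, 0 < aW ∧ ∀ a₀ : ℝ, 0 < a₀ → a₀ ≤ aW → ∃ εw γw : ℝ, 0 < εw ∧ 0 < γw ∧ γw ≤ 1 / 2 ∧ ∀ ε₂₉ : ℝ, 0 < ε₂₉ → ε₂₉ ≤ εw →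
        (letI θ := thetaFill F a₀ ε₂₉; letI := θ.instVβ₁; letI := θ.instVβ₂; letI := θ.instιβ;
         (∀ k K : ℕ, ContinuousOn (fun v : Fin (k + 1) → ℝ => fderiv ℝ (fderiv ℝ (B12PolarizationTensor120.expChart (recordTermsAx F a₀ ε₂₉ k v K) θ.ρ8)) 0) (FlowStep.Box γw k))) ∧
         ∃ e : ℕ → ℝ, RecordPlimMomentNegPartOnBoxAx F a₀ ε₂₉ γw e) :
    ∀ (F : T4Family) (a : ℝ), 0 < a → CofinalBetaSocketAxBody F a :=
  cofinalBetaSocketAxBody_allRadii_of_sig8LR4BoxCofinal_uk_old_scheme_winC h8c hUk hOld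
    (fun F => (residualScheme_iff_residualSchemeNatural F).2 (hSch F)) hWinC

end Summit.QuantumFields.YangMills.Theorems.K0AxJoinResidualBoxSchemeNatural
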